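import Literature.Analysis.FluidPDE.TransportHolderEstimate
import Mathlib.MeasureTheory.Integral.IntervalIntegral.FundThmCalculus
import HarnessLib

/-!
# Lagrangian trajectories of a smooth torus drift perturbed by an additive continuous path
(the pathwise content of Johansson–Sorella 2024, Def. 2.6 "backward stochastic flow")

Topic `Literature/Analysis/FluidPDE` (theorems only). C. J. P. Johansson, M. Sorella,
arXiv:2409.03599 (Duke Math. J. 2025), Def. 2.6 (p. 9): for a two-dimensional Brownian motion
`W`, an autonomous divergence-free drift `u` and a noise constant `√(2κ)`, the backward stochastic
flow `X^κ_{T,t}` is the solution of `dX^κ_{T,t} = u(X^κ_{T,t}) dt + √(2κ) dW_t`, `X^κ_{T,T}(x,ω) ≡ x`.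
Since the noise is ADDITIVE, for each sample path `ω` this is an ordinary integral equation
driven by the continuous path `w = √(2κ) W(ω)`:

  `X(s) = y + ∫_{t₀}^{s} u(r, X(r)) dr + (w(s) - w(t₀))`,

equivalently `Y = X - (w - w(t₀))` solves the classical ODE `Y'(s) = u(r, Y(s) + w(s) - w(t₀))`
with the noise-shifted (still Lipschitz, still bounded) field. No stochastic integration is
involved. This file builds these pathwise objects for a drift jointly smooth on `[a,b] × T^d`
(time-dependent allowed; lifted to the periodic field `lift (u s)` on `ℝ^d`) and an arbitrary path
`w` continuous on `[a,b]`, through every `(t₀, y)` — both forward and backward in time, so that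
Def. 2.6 is the case `t₀ = T = b`:

* `Torus.exists_lipschitzWith_lift_of_isSmoothSpaceTimeOn` — a uniform spatial Lipschitz constant
  for the lifted drift on `[a,b]`;
* `Torus.exists_noisyCharacteristic` — global existence on `[a,b]` (Picard–Lindelöf, Mathlib
  `IsPicardLindelof`, on a ball of radius `sup|u|·(b-a)`);
* `Torus.dist_noisyCharacteristic_le` — two-sided Grönwall bound
  `|Y₁(s) - Y₂(s)| ≤ |Y₁(t) - Y₂(t)| e^{K|s-t|}`, whence uniqueness
  (`Torus.noisyCharacteristic_unique`) and lattice equivariance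
  (`Torus.noisyCharacteristic_add_latticeVec`);
* `Torus.exists_noisyFlow` — the simultaneous family `Y y` for all `y ∈ ℝ^d`: Lipschitz in the
  initial point, `ℤ^d`-equivariant, satisfying the integral equation of Def. 2.6 for
  `X y s = Y y s + (w s - w t₀)`, and descending to continuous maps `φ s : T^d → T^d` with
  `φ s (proj y) = proj (X y s)`.

Measure preservation of `φ s` (Liouville's theorem for the divergence-free case, the property
used in Lemma 2.8 of the source) and the Feynman–Kac representation (Thm. 2.7) are NOT treated
here. The ODE toolkit is Mathlib's (`IsPicardLindelof`, Grönwall) together with the tree's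
`TransportHolderEstimate` (two-sided Grönwall `Torus.dist_trajectories_le_two_sided`, Lipschitz
lifts).

## References

* C. J. P. Johansson, M. Sorella, arXiv:2409.03599v2 (2024), Def. 2.6 (backward stochastic flow),
  p. 9; §2.2. [`JohanssonSorella2024`]
* H. Kunita, *Stochastic differential equations and stochastic flows of diffeomorphisms*,
  Saint-Flour XII (1984) (cited by the source for Thm. 2.7).
-/

noncomputable section

open MeasureTheory Set Filter Metric Function
open scoped NNReal ENNReal ContDiff Topology

namespace Literature.Analysis.FluidPDE

namespace Torus

open FunctionSpaces FunctionSpaces.Torus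

variable {d : Type*} [Fintype d]

section Lipschitz

variable [DecidableEq d]

/-- **Uniform spatial Lipschitz constant of a smooth drift.** For `u` jointly smooth on
`[a,b] × T^d`, `a < b`, the lifts `lift (u s)`, `s ∈ [a,b]`, are Lipschitz on `ℝ^d` with one
constant (the partial derivatives are jointly continuous, hence bounded on the compact
`[a,b] × T^d`; mean value inequality). [folklore] -/
theorem exists_lipschitzWith_lift_of_isSmoothSpaceTimeOn {a b : ℝ} (hab : a < b)
    {u : ℝ → UnitAddTorus d → EuclideanSpace ℝ d} (hu : IsSmoothSpaceTimeOn (Icc a b) u) :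
    ∃ K : ℝ≥0, ∀ s ∈ Icc a b, LipschitzWith K (lift (u s)) := by
  have hS' : UniqueDiffOn ℝ (Icc a b) := uniqueDiffOn_Icc hab
  choose C hC using fun i => (hu.partialDeriv hS' i).exists_norm_le_of_isCompact isCompact_Icc subset_rfl
  have hC0 : 0 ≤ ∑ i, C i := Finset.sum_nonneg fun i _ =>
    (norm_nonneg _).trans (hC i a (left_mem_Icc.2 hab.le) 0)
  refine ⟨⟨∑ i, C i, hC0⟩, fun s hs => ?_⟩
  have h1 : IsContDiff 1 (u s) := (hu.isSmooth_slice hs).isContDiff (by simp)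
  refine lipschitzWith_of_nnnorm_fderiv_le (h1.differentiable one_ne_zero) fun y => ?_
  rw [← NNReal.coe_le_coe, coe_nnnorm]
  exact norm_fderiv_lift_le_of_norm_partialDeriv_le h1 (fun i x => hC i s hs x) y

end Lipschitz

variable {a b t₀ : ℝ} {u : ℝ → UnitAddTorus d → EuclideanSpace ℝ d}
  {w : ℝ → EuclideanSpace ℝ d} {K : ℝ≥0}

/-- The noise-shifted lifted drift `z ↦ u(s, z + c)` is `K`-Lipschitz when the lift is. [folklore] -/
theorem lipschitzWith_lift_comp_add (hK : ∀ s ∈ Icc a b, LipschitzWith K (lift (u s))) {s : ℝ}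
    (hs : s ∈ Icc a b) (c : EuclideanSpace ℝ d) :
    LipschitzWith K (fun z => lift (u s) (z + c)) := fun z z' => by
  have h := hK s hs (z + c) (z' + c)
  rwa [edist_add_right] at h

/-- **Existence of noise-perturbed characteristics on the whole interval** (pathwise form of
JS24 Def. 2.6). For `u` jointly smooth on `[a,b] × T^d` with `K`-Lipschitz lifts, a path `w`
continuous on `[a,b]`, `t₀ ∈ [a,b]` and `y ∈ ℝ^d`, there is `Y : ℝ → ℝ^d` with `Y t₀ = y` and
`Y'(s) = u(s, Y(s) + w(s) - w(t₀))` within `[a,b]` (so `X = Y + w - w(t₀)` solves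
`X(s) = y + ∫_{t₀}^s u(r, X(r)) dr + w(s) - w(t₀)`). Picard–Lindelöf on the ball of radius
`sup|u| · (b - a)` about `y`. [cite: JohanssonSorella2024, Def. 2.6, p. 9] -/
theorem exists_noisyCharacteristic (hu : IsSmoothSpaceTimeOn (Icc a b) u)
    (hK : ∀ s ∈ Icc a b, LipschitzWith K (lift (u s))) (hw : ContinuousOn w (Icc a b))
    (ht₀ : t₀ ∈ Icc a b) (y : EuclideanSpace ℝ d) :
    ∃ Y : ℝ → EuclideanSpace ℝ d, Y t₀ = y ∧
      ∀ s ∈ Icc a b, HasDerivWithinAt Y (lift (u s) (Y s + (w s - w t₀))) (Icc a b) s := by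
  obtain ⟨M, hM⟩ := hu.exists_norm_le_of_isCompact isCompact_Icc subset_rfl
  have hM0 : 0 ≤ M := (norm_nonneg _).trans (hM t₀ ht₀ (proj y))
  set L : ℝ≥0 := ⟨M, hM0⟩ with hL
  have hab : a ≤ b := ht₀.1.trans ht₀.2
  set R : ℝ≥0 := ⟨M * (b - a), mul_nonneg hM0 (sub_nonneg.2 hab)⟩ with hR
  have hPL : IsPicardLindelof (fun s z => lift (u s) (z + (w s - w t₀))) (⟨t₀, ht₀⟩ : Icc a b) y R 0 L K := by
    refine ⟨fun s hs => (lipschitzWith_lift_comp_add hK hs _).lipschitzOnWith, fun z _ => ?_,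
      fun s hs z _ => ?_, ?_⟩
    · have hc := hu.continuousOn_stLift
      have h2 : ContinuousOn (fun s : ℝ => ((s, z + (w s - w t₀)) : ℝ × EuclideanSpace ℝ d))
          (Icc a b) :=
        continuousOn_id.prodMk (continuousOn_const.add (hw.sub continuousOn_const))
      exact hc.comp h2 fun s hs => mk_mem_prod hs (mem_univ _)
    · exact hM s hs (proj _)
    · rw [NNReal.coe_zero, sub_zero]
      change M * max (b - t₀) (t₀ - a) ≤ M * (b - a)
      exact mul_le_mul_of_nonneg_left (max_le (by linarith [ht₀.1]) (by linarith [ht₀.2])) hM0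
  exact hPL.exists_eq_forall_mem_Icc_hasDerivWithinAt₀

/-- **Two-sided Grönwall bound for noise-perturbed characteristics**: two solutions of
`Y' = u(s, Y + w(s) - w(t₀))` within `[a,b]` satisfy
`dist (Y₁ s) (Y₂ s) ≤ dist (Y₁ t) (Y₂ t) e^{K|s-t|}` (`Torus.dist_trajectories_le_two_sided`
for the shifted field, which is `K`-Lipschitz at every time). [folklore] -/
theorem dist_noisyCharacteristic_le (hK : ∀ s ∈ Icc a b, LipschitzWith K (lift (u s)))
    {Y₁ Y₂ : ℝ → EuclideanSpace ℝ d}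
    (h₁ : ∀ s ∈ Icc a b, HasDerivWithinAt Y₁ (lift (u s) (Y₁ s + (w s - w t₀))) (Icc a b) s)
    (h₂ : ∀ s ∈ Icc a b, HasDerivWithinAt Y₂ (lift (u s) (Y₂ s + (w s - w t₀))) (Icc a b) s)
    {t s : ℝ} (ht : t ∈ Icc a b) (hs : s ∈ Icc a b) :
    dist (Y₁ s) (Y₂ s) ≤ dist (Y₁ t) (Y₂ t) * Real.exp (K * |s - t|) :=
  dist_trajectories_le_two_sided (v := fun s z => lift (u s) (z + (w s - w t₀)))
    (fun _ hs' => lipschitzWith_lift_comp_add hK hs' _) h₁ h₂ ht hs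

/-- **Uniqueness of noise-perturbed characteristics**: two solutions on `[a,b]` that agree at one
time `t ∈ [a,b]` agree on `[a,b]`. [folklore] -/
theorem noisyCharacteristic_unique (hK : ∀ s ∈ Icc a b, LipschitzWith K (lift (u s)))
    {Y₁ Y₂ : ℝ → EuclideanSpace ℝ d}
    (h₁ : ∀ s ∈ Icc a b, HasDerivWithinAt Y₁ (lift (u s) (Y₁ s + (w s - w t₀))) (Icc a b) s)
    (h₂ : ∀ s ∈ Icc a b, HasDerivWithinAt Y₂ (lift (u s) (Y₂ s + (w s - w t₀))) (Icc a b) s)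
    {t : ℝ} (ht : t ∈ Icc a b) (heq : Y₁ t = Y₂ t) : EqOn Y₁ Y₂ (Icc a b) := fun s hs => by
  have h := dist_noisyCharacteristic_le hK h₁ h₂ ht hs
  rw [heq, dist_self, zero_mul] at h
  exact dist_le_zero.1 h

/-- **Lattice equivariance**: if `Y` solves the noise-perturbed characteristic equation, so does
`Y + k` for every lattice vector `k ∈ ℤ^d` (the lifted drift is `ℤ^d`-periodic). [folklore] -/
theorem noisyCharacteristic_add_latticeVec [DecidableEq d] {Y : ℝ → EuclideanSpace ℝ d}
    (h : ∀ s ∈ Icc a b, HasDerivWithinAt Y (lift (u s) (Y s + (w s - w t₀))) (Icc a b) s)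
    (k : d → ℤ) :
    ∀ s ∈ Icc a b, HasDerivWithinAt (fun σ => Y σ + latticeVec k)
      (lift (u s) ((Y s + latticeVec k) + (w s - w t₀))) (Icc a b) s := fun s hs => by
  have hper : lift (u s) ((Y s + latticeVec k) + (w s - w t₀)) = lift (u s) (Y s + (w s - w t₀)) := by
    rw [add_right_comm, lift_apply, lift_apply, proj_add_latticeVec]
  rw [hper]
  exact (h s hs).add_const (latticeVec k)

/-- **The pathwise noisy Lagrangian flow** (JS24 Def. 2.6, pathwise, forward and backward).
For `u` jointly smooth on `[a,b] × T^d`, `a < b`, a path `w` continuous on `[a,b]` and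
`t₀ ∈ [a,b]` there is a family `Y : ℝ^d → ℝ → ℝ^d` such that, with `X y s = Y y s + (w s - w t₀)`:
(i) `Y y t₀ = y`; (ii) `Y y` solves `Y' = u(s, Y + w(s) - w(t₀))` within `[a,b]`;
(iii) `dist (Y y₁ s) (Y y₂ s) ≤ dist y₁ y₂ · e^{K|s-t₀|}` for some `K` (Lipschitz dependence on
the initial point); (iv) `Y (y + k) s = Y y s + k` for `k ∈ ℤ^d` (equivariance, so the flow lives
on the torus); (v) the integral equation `X y s = y + ∫_{t₀}^s u(r, X y r) dr + (w s - w t₀)` of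
Def. 2.6; and (vi) continuous maps `φ s : T^d → T^d`, `s ∈ [a,b]`, with
`φ s (proj y) = proj (X y s)`. [cite: JohanssonSorella2024, Def. 2.6, p. 9] -/
theorem exists_noisyFlow [DecidableEq d] (hab : a < b) (hu : IsSmoothSpaceTimeOn (Icc a b) u)
    (hw : ContinuousOn w (Icc a b)) (ht₀ : t₀ ∈ Icc a b) :
    ∃ (Y : EuclideanSpace ℝ d → ℝ → EuclideanSpace ℝ d) (φ : ℝ → UnitAddTorus d → UnitAddTorus d),
      (∀ y, Y y t₀ = y) ∧
      (∀ y, ∀ s ∈ Icc a b,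
        HasDerivWithinAt (Y y) (lift (u s) (Y y s + (w s - w t₀))) (Icc a b) s) ∧
      (∃ K : ℝ≥0, ∀ s ∈ Icc a b, ∀ y₁ y₂,
        dist (Y y₁ s) (Y y₂ s) ≤ dist y₁ y₂ * Real.exp (K * |s - t₀|)) ∧
      (∀ y (k : d → ℤ), ∀ s ∈ Icc a b, Y (y + latticeVec k) s = Y y s + latticeVec k) ∧
      (∀ y, ∀ s ∈ Icc a b, Y y s + (w s - w t₀) =
        y + (∫ r in t₀..s, lift (u r) (Y y r + (w r - w t₀))) + (w s - w t₀)) ∧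
      (∀ s ∈ Icc a b, ∀ y, φ s (proj y) = proj (Y y s + (w s - w t₀))) ∧
      (∀ s ∈ Icc a b, Continuous (φ s)) := by
  obtain ⟨K, hK⟩ := exists_lipschitzWith_lift_of_isSmoothSpaceTimeOn hab hu
  choose Y hY0 hY using fun y => exists_noisyCharacteristic hu hK hw ht₀ y
  -- (iii) Lipschitz dependence on the initial point
  have hLip : ∀ s ∈ Icc a b, ∀ y₁ y₂, dist (Y y₁ s) (Y y₂ s) ≤ dist y₁ y₂ * Real.exp (K * |s - t₀|) := by
    intro s hs y₁ y₂
    have h := dist_noisyCharacteristic_le hK (hY y₁) (hY y₂) ht₀ hs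
    rwa [hY0, hY0] at h
  -- (iv) equivariance
  have hEq : ∀ y (k : d → ℤ), ∀ s ∈ Icc a b, Y (y + latticeVec k) s = Y y s + latticeVec k := by
    intro y k s hs
    have h := noisyCharacteristic_unique hK (hY (y + latticeVec k))
      (noisyCharacteristic_add_latticeVec (hY y) k) ht₀ (by simp only [hY0])
    exact h hs
  -- (v) the integral equation
  have hcontY : ∀ y, ContinuousOn (Y y) (Icc a b) := fun y s hs => (hY y s hs).continuousWithinAt
  have hcontF : ∀ y, ContinuousOn (fun r => lift (u r) (Y y r + (w r - w t₀))) (Icc a b) := by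
    intro y
    have hc := hu.continuousOn_stLift
    have h2 : ContinuousOn (fun r : ℝ => ((r, Y y r + (w r - w t₀)) : ℝ × EuclideanSpace ℝ d))
        (Icc a b) :=
      continuousOn_id.prodMk ((hcontY y).add (hw.sub continuousOn_const))
    exact hc.comp h2 fun r hr => mk_mem_prod hr (mem_univ _)
  have hInt : ∀ y, ∀ s ∈ Icc a b,
      Y y s + (w s - w t₀) = y + (∫ r in t₀..s, lift (u r) (Y y r + (w r - w t₀))) + (w s - w t₀) := by
    intro y s hs
    suffices hFTC : ∫ r in t₀..s, lift (u r) (Y y r + (w r - w t₀)) = Y y s - Y y t₀ by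
      rw [hFTC, hY0]; abel
    rcases le_total t₀ s with hle | hle
    · have hsub : Icc t₀ s ⊆ Icc a b := Icc_subset_Icc ht₀.1 hs.2
      exact intervalIntegral.integral_eq_sub_of_hasDerivAt_of_le hle ((hcontY y).mono hsub)
        (fun r hr => ((hY y r (hsub (Ioo_subset_Icc_self hr))).hasDerivAt
          (Icc_mem_nhds (ht₀.1.trans_lt hr.1) (hr.2.trans_le hs.2))))
        (((hcontF y).mono hsub).intervalIntegrable_of_Icc hle)
    · have hsub : Icc s t₀ ⊆ Icc a b := Icc_subset_Icc hs.1 ht₀.2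
      rw [intervalIntegral.integral_symm,
        intervalIntegral.integral_eq_sub_of_hasDerivAt_of_le hle ((hcontY y).mono hsub)
          (fun r hr => ((hY y r (hsub (Ioo_subset_Icc_self hr))).hasDerivAt
            (Icc_mem_nhds (hs.1.trans_lt hr.1) (hr.2.trans_le ht₀.2))))
          (((hcontF y).mono hsub).intervalIntegrable_of_Icc hle)]
      abel
  -- (vi) descent to the torus
  have hrepr : ∀ y : EuclideanSpace ℝ d, ∃ k : d → ℤ, repr (proj y) = y + latticeVec k := fun y =>
    (proj_eq_proj_iff_holds y (repr (proj y))).1 (proj_repr (proj y)).symm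
  set φ : ℝ → UnitAddTorus d → UnitAddTorus d := fun s x => proj (Y (repr x) s + (w s - w t₀)) with hφ
  have hφproj : ∀ s ∈ Icc a b, ∀ y, φ s (proj y) = proj (Y y s + (w s - w t₀)) := by
    intro s hs y
    obtain ⟨k, hk⟩ := hrepr y
    simp only [hφ]
    rw [hk, hEq y k s hs, add_right_comm, proj_add_latticeVec]
  have hφcont : ∀ s ∈ Icc a b, Continuous (φ s) := by
    intro s hs
    rw [← continuous_lift_iff]
    have hl : lift (φ s) = fun y => proj (Y y s + (w s - w t₀)) := by
      funext y
      rw [lift_apply, hφproj s hs y]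
    rw [hl]
    have hYc : Continuous fun y => Y y s := by
      refine (LipschitzWith.of_dist_le_mul (K := (Real.exp (K * |s - t₀|)).toNNReal)
        (f := fun y => Y y s) fun y₁ y₂ => ?_).continuous
      rw [Real.coe_toNNReal _ (Real.exp_pos _).le, mul_comm]
      exact hLip s hs y₁ y₂
    exact continuous_proj.comp (hYc.add continuous_const)
  exact ⟨Y, φ, hY0, hY, ⟨K, hLip⟩, hEq, hInt, hφproj, hφcont⟩

end Torus

end Literature.Analysis.FluidPDE

end
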